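import Literature.AlgebraicGeometry.Hu2025.Proofs.S04ModelV.GoverningBinomials
import HarnessLib

/-!
# Hu 2025 row 105 — the count (4.47) of the printed LIST of governing binomials (kernel; D-lane): `Eq4_47_ours` holds for every
# nontrivial coefficient ring, every finite term type and every model datum with `rel (head F) = F`

`s ↦ B_{F,s}` is injective on the non-leading terms of the block `F` (the ϱ-variable `x_{(s)}` is read off the support), so the list
`{B_{F,s} : s ∈ S_F ∖ s_F}` has `|S_F| − 1` members. Bookkeeping on rows 103/105 definitions only. AI-written; weaker than expert review.
-/

noncomputable section

namespace Literature.AlgebraicGeometry.Hu2025.Proofs.S04ModelV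

open MvPolynomial Literature.AlgebraicGeometry.Hu2025.Statements.S04ModelV

universe u v w x

variable {k : Type u} [CommRing k] {σ : Type v} {T : Type w} {𝔗 : Type x}

/-- **`s ↦ B_{F,s}` is injective** on terms `s ≠ head F` (nontrivial coefficients). [cite: Hu2025, §4.5 (4.41)/(4.46)/(4.47), chunks p0031 l.175–181 / p0032 l.9–24, l.41–49 (unrefereed preprint arXiv:2507.21400v1 under adjudication, D-0012/D-0089 — kernel support on OUR typed carriers of rows 103/105; nothing of the source asserted)] -/
theorem govBinomial_injOn [Nontrivial k] (mono : T → (σ →₀ ℕ)) (head : 𝔗 → T) (F : 𝔗) :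
    Set.InjOn (govBinomial (k := k) mono head F) {s | s ≠ head F} := by
  intro s hs s' hs' h
  simp only [Set.mem_setOf_eq] at hs hs'
  simp only [govBinomial] at h
  -- the exponent of `x̄_{head F}·x_{(s)}` lies in the support of `B_{F,s}`, hence of `B_{F,s'}`
  have hmem : (((mono (head F)).mapDomain Sum.inl + Finsupp.single (Sum.inr s) 1 : σ ⊕ T →₀ ℕ)) ∈ (wpBinomial (k := k) mono s' (head F)).support := by
    rw [← h]; exact (mem_support_wpBinomial_iff mono hs _).mpr (Or.inl rfl)
  rw [mem_support_wpBinomial_iff mono hs'] at hmem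
  rcases hmem with h1 | h1
  · have := congrArg (fun d => d (Sum.inr s)) h1
    simp only [wpExp_inr_self] at this
    by_contra hss'
    rw [wpExp_inr_of_ne mono (head F) s' hss'] at this
    exact one_ne_zero this
  · have := congrArg (fun d => d (Sum.inr s)) h1
    rw [wpExp_inr_self, wpExp_inr_of_ne mono s' (head F) hs] at this
    exact absurd this one_ne_zero

/-- **`Eq4_47_ours` holds**: the printed list `{B_{F,s} : s ∈ S_F ∖ s_F}` has `|S_F| − 1` members, for every nontrivial coefficient
ring, finite term type and model datum with `rel (head F) = F`. [cite: Hu2025, §4.5 (4.41)/(4.46)/(4.47), chunks p0031 l.175–181 / p0032 l.9–24, l.41–49 (unrefereed preprint arXiv:2507.21400v1 under adjudication, D-0012/D-0089 — kernel support on OUR typed carriers of rows 103/105; nothing of the source asserted)] -/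
theorem eq4_47_ours_of_nontrivial [Nontrivial k] [Finite T] (rel : T → 𝔗) (mono : T → (σ →₀ ℕ)) (head : 𝔗 → T)
    (hhead : ∀ F, rel (head F) = F) : Eq4_47_ours (k := k) (σ := σ) rel mono head := by
  classical
  intro F
  -- the listed set is the image of the non-leading terms of the block
  have hset : {f : ModelRing σ T k | ∃ s : T, rel s = F ∧ s ≠ head F ∧ f = govBinomial (k := k) mono head F s} =
      govBinomial (k := k) mono head F '' {s | rel s = F ∧ s ≠ head F} := by
    ext f
    simp only [Set.mem_setOf_eq, Set.mem_image]
    constructor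
    · rintro ⟨s, h1, h2, rfl⟩; exact ⟨s, ⟨h1, h2⟩, rfl⟩
    · rintro ⟨s, ⟨h1, h2⟩, rfl⟩; exact ⟨s, h1, h2, rfl⟩
  rw [hset, Nat.card_image_of_injOn ((govBinomial_injOn (k := k) mono head F).mono fun s hs => hs.2)]
  -- count the non-leading terms of the block: all terms of the block minus the leading one
  haveI := Fintype.ofFinite T
  rw [Nat.card_eq_fintype_card, Nat.card_eq_fintype_card, Fintype.card_subtype, Fintype.card_subtype]
  simp only [Set.mem_setOf_eq]
  have hfilter : (Finset.univ.filter fun s : T => rel s = F ∧ s ≠ head F) =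
      (Finset.univ.filter fun s : T => rel s = F).erase (head F) := by
    ext s
    simp only [Finset.mem_filter, Finset.mem_univ, true_and, Finset.mem_erase]
    tauto
  rw [hfilter, Finset.card_erase_of_mem]
  simpa using hhead F

end Literature.AlgebraicGeometry.Hu2025.Proofs.S04ModelV

end
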